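import Literature.Geometry.Symplectic.LefschetzSteinOpenBookFlatModel
import Literature.Geometry.Symplectic.LefschetzSteinOpenBookBaseCase
import Literature.Geometry.Symplectic.LefschetzBaseModelReebPositive
import Literature.Geometry.Symplectic.LefschetzBaseModelSteinOrient
import Literature.Geometry.Symplectic.SublevelSteinReebGradient
import HarnessLib

/-!
# PALF ⇒ Stein with supported boundary open book: the handle-free case, proved

Topic `Literature/Geometry/Symplectic`; a proofs-only companion (no definition, no named fact) of
`LefschetzSteinOpenBook.lean`, closing the FIRST STEP of the named fact
`Literature.Geometry.Symplectic.palf_stein_supportedByBoundaryOpenBook` (Akbulut–Ozbagci 2001,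
Thm. 5; Torisu 2000 / Etnyre 2006 Thm. 5.6 ¶1: *"`X₀ = D² × F` is Stein and its boundary open
book supports the boundary contact structure"*) for an EMPTY family of vanishing cycles:

* `palf_stein_supportedByBoundaryOpenBook_handleFree` — for `h : ι → …` with `IsEmpty ι`, every
  compact multi-attachment `(X, D)`, boundary datum `bX` and Kas open book `ob`
  (`IsKasOpenBookOf g h D bX.incl ob`), there is a Stein structure on `X` with a Giroux form of
  `ob` for its complex tangencies, positive for the complex boundary orientation;
* `palf_stein_supportedByBoundaryOpenBook_base_holds` — the same for `Base g` itself with its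
  boundary open book `boundaryOpenBook g` (the corollary
  `palf_stein_supportedByBoundaryOpenBook.base_case` of `LefschetzSteinOpenBookBaseCase.lean`,
  unconditionally).

**Proof.**  `palf_conclusion_of_flatReebModel'` (`LefschetzSteinOpenBookFlatModel.lean`) reduces
the statement to a flat Reeb-compatible Stein model of the base; the model is the rounded convex
model `X_Ψ = {Ψ ≤ 1/4}`, `Ψ = modelFun g ε (qPert δ) = ‖w‖² + Θ(‖x‖²) + ε(‖x‖² + δ m(‖y‖²))`
(`LefschetzBaseModelStein.lean`), identified with `Base g` over a page-preserving,
orientation-preserving diffeomorphism `Φ` of `ℂ²` (`exists_steinStructure_model_orient_le`, the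
thresholds `δ, ε` now adjustable), and the field is `R = J₀ G`, `G` the gradient of `Ψ` for the
Levi metric `h(u, v) = D²Ψ(u, v) + D²Ψ(J₀u, J₀v)` on the level (`exists_leviGradient`).  The flat
Reeb conditions: (F0) `dΨ(J₀G) = h(G, J₀G) = 0` and (F2) `dd^ℂΨ(J₀G, v) = h(G, v) = dΨ(v)` by the
symmetry of `D²Ψ`; (F1) `-dΨ(J₀J₀G) = h(G, G) > 0`; (F3) `Im(w̄ Dw(J₀G)) = Re(w̄ Dw(G)) > 0` off
the binding is `exists_re_conj_w_mul_wD_pos` (`LefschetzBaseModelReebPositive.lean`); (F4) at a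
binding point of the level `‖y‖² > 3/10` (`norm_sq_cy_gt_of_binding_level`), so `Dw(G) = w/2 = 0`
(`wD_leviGradient_of_gt`) and `ker dΨ ∩ ker Dw = ℝ · J₀G` by complex-coordinate algebra
(`eq_smul_of_ker`); (F5) `-dd^ℂΨ(e₁, e₂) = h(J₀e₁, e₂) > 0` for `e₁, e₂ ∈ ker dΨ` with
`Im(conj(Dw e₁) Dw e₂) > 0` at a binding point, by `h`-orthogonal projection off `J₀G` and the
complex-line structure of the `h`-complement of `ℂ G` (`bil_J_pos_of_meridional`).

## References

* S. Akbulut, B. Ozbagci, *Lefschetz fibrations on compact Stein surfaces*, Geom. Topol. 5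
  (2001), Thm. 5 and its proof, first step. [AkbulutOzbagci2001]
* I. Torisu, *Convex contact structures and fibered links in 3-manifolds*, IMRN 2000:9, 441–454.
* J. B. Etnyre, *Lectures on open book decompositions and contact structures*, Clay Math. Proc.
  5 (2006), Lemma 3.3, Thm. 5.6. [Etnyre2006]
-/

noncomputable section

open scoped Manifold ContDiff Topology ComplexConjugate
open Set Function Filter Complex
open Literature.Geometry.Kaehler Literature.Topology.FourManifolds
  Literature.Topology.FourManifolds.HandleAttachingMap
  Literature.Topology.FourManifolds.LefschetzBase

namespace Literature.Geometry.Symplectic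

open LefschetzBaseSteinModel

/-! ### §1 The Stein model with adjustable thresholds -/

/-- **The rounded convex Stein model of the base, thresholds adjustable.**  As
`exists_steinStructure_model_orient`, with `δ ≤ δ'`, `ε ≤ ε'` prescribed.
[cite: AkbulutOzbagci2001, Thm. 5] -/
theorem exists_steinStructure_model_orient_le (g : ℕ) {δ' ε' : ℝ} (hδ' : 0 < δ') (hε' : 0 < ε') :
    ∃ δ : ℝ, 0 < δ ∧ δ ≤ δ' ∧ ∃ ε : ℝ, 0 < ε ∧ ε ≤ ε' ∧
      ∃ (hΨ : IsRegularLevel (𝓡 4) (modelFun g ε (qPert δ)) (1 / 4))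
        (_ : CompactSpace (RegularSublevel hΨ))
        (Φ : EuclideanSpace ℝ (Fin 4) ≃ₘ⟮𝓘(ℝ, EuclideanSpace ℝ (Fin 4)),
          𝓘(ℝ, EuclideanSpace ℝ (Fin 4))⟯ EuclideanSpace ℝ (Fin 4))
        (e : Base g ≃ₘ⟮𝓡∂ 4, 𝓡∂ 4⟯ RegularSublevel hΨ)
        (S : SteinStructure (RegularSublevel hΨ)),
        (∀ p, RegularSublevel.incl hΨ (e p) = Φ (RegularSublevel.incl (isRegularLevel_rho g) p)) ∧
        Φ '' (LefschetzBase.rho g ⁻¹' Iic (1 / 4)) = modelFun g ε (qPert δ) ⁻¹' Iic (1 / 4) ∧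
        Φ '' (LefschetzBase.rho g ⁻¹' {1 / 4}) = modelFun g ε (qPert δ) ⁻¹' {1 / 4} ∧
        (∀ z, ∃ r : ℝ, 0 < r ∧ w g (Φ z) = (r : ℂ) * w g z) ∧
        (∀ z, 0 < LinearMap.det (fderiv ℝ Φ z :
          EuclideanSpace ℝ (Fin 4) →ₗ[ℝ] EuclideanSpace ℝ (Fin 4))) ∧
        (∀ z, LefschetzBase.rho g z ≤ 1 / 4 → ∀ u : EuclideanSpace ℝ (Fin 4), u ≠ 0 →
          0 < fderiv ℝ (fderiv ℝ (modelFun g ε (qPert δ))) z u u +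
            fderiv ℝ (fderiv ℝ (modelFun g ε (qPert δ))) z (stdComplexStructure u)
              (stdComplexStructure u)) ∧
        S.φ = sublevelPhi hΨ ∧ S.J = sublevelJ hΨ stdComplexStructure := by
  obtain ⟨δ₀, hδ₀, Hpsh⟩ := exists_levi_modelFun_pos g
  set δ := min δ₀ δ' with hδdef
  have hδ : 0 < δ := lt_min hδ₀ hδ'
  obtain ⟨ε₀, hε₀, Hid⟩ :=
    exists_model_diffeomorph_orient g (contDiff_qPert δ) (qPert_nonneg hδ.le)
  set ε := min (min ε₀ 1) ε' with hεdef
  have hε : 0 < ε := lt_min (lt_min hε₀ one_pos) hε'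
  obtain ⟨hΨ, Φ, e, he, hle, heq, hw, hdet⟩ :=
    Hid ε hε.le ((min_le_left _ _).trans (min_le_left _ _))
  have hpsh := Hpsh δ hδ (min_le_left _ _) ε hε ((min_le_left _ _).trans (min_le_right _ _))
  haveI : CompactSpace (RegularSublevel hΨ) := isCompact_iff_compactSpace.1
    (isCompact_modelFun_le g hε.le (contDiff_qPert δ) (qPert_nonneg hδ.le))
  obtain ⟨S, hSφ, hSJ⟩ := exists_steinStructure_sublevel_of_levi_pos hΨ stdComplexStructure
    stdComplexStructure_sq (exists_modelFun_qPert_eq g ε δ)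
    (fun z hz u hu => hpsh z ((rho_le_modelFun g hε.le (qPert_nonneg hδ.le) z).trans hz) u hu)
  exact ⟨δ, hδ, min_le_right _ _, ε, hε, min_le_right _ _, hΨ, inferInstance, Φ, e, S, he, hle,
    heq, hw, hdet, hpsh, hSφ, hSJ⟩

/-! ### §2 The binding of the level lies in the region `‖y‖² > 3/10` -/

/-- **At a binding point of the level `{Ψ = 1/4}` (`w = 0`), `‖y‖² > 3/10`** (for
`0 ≤ ε ≤ 1/40`, `0 ≤ δ ≤ 1`): otherwise `x^{2g+1} = y² - 1` has norm `< 2`, so `‖x‖² < 4`,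
`Θ = 0` and `Ψ = ε(‖x‖² + δ m) < 1/4`. [folklore] -/
theorem norm_sq_cy_gt_of_binding_level {g : ℕ} {ε δ : ℝ} (hε' : ε ≤ 1 / 40)
    (hδ : 0 ≤ δ) (hδ' : δ ≤ 1) {z : EuclideanSpace ℝ (Fin 4)}
    (hz : modelFun g ε (qPert δ) z = 1 / 4) (hw : w g z = 0) : 3 / 10 < ‖cy z‖ ^ 2 := by
  by_contra ht
  rw [not_lt] at ht
  -- `x^{2g+1} = y² - 1`
  have hx : cx z ^ (2 * g + 1) = cy z ^ 2 - 1 := by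
    have := cy_sq_eq g z
    rw [hw] at this
    linear_combination -this
  have hn : ‖cx z‖ ^ (2 * g + 1) < 2 := by
    rw [← norm_pow, hx]
    calc ‖cy z ^ 2 - 1‖ ≤ ‖cy z ^ 2‖ + ‖(1 : ℂ)‖ := norm_sub_le _ _
      _ = ‖cy z‖ ^ 2 + 1 := by rw [norm_pow, norm_one]
      _ < 2 := by linarith
  have hx2 : ‖cx z‖ < 2 := by
    by_contra h2
    rw [not_lt] at h2
    have : (2 : ℝ) ^ (2 * g + 1) ≤ ‖cx z‖ ^ (2 * g + 1) := pow_le_pow_left₀ (by norm_num) h2 _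
    have h4 : (2 : ℝ) ≤ 2 ^ (2 * g + 1) := by
      calc (2 : ℝ) = 2 ^ 1 := (pow_one _).symm
        _ ≤ 2 ^ (2 * g + 1) := pow_le_pow_right₀ (by norm_num) (by omega)
    linarith
  have hs : ‖cx z‖ ^ 2 < 4 := by nlinarith [norm_nonneg (cx z)]
  have hΘ : convexProfile (‖cx z‖ ^ 2) = 0 := convexProfile_of_le_four hs.le
  have hm : yMass (‖cy z‖ ^ 2) ≤ ‖cy z‖ ^ 2 := yMass_le (sq_nonneg _)
  have hm0 : 0 ≤ yMass (‖cy z‖ ^ 2) := yMass_nonneg (sq_nonneg _)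
  rw [modelFun_apply, qPert_apply, hΘ, hw, norm_zero] at hz
  have h1 : δ * yMass (‖cy z‖ ^ 2) ≤ 1 * (3 / 10) := mul_le_mul hδ' (hm.trans ht) hm0 zero_le_one
  have h2 : ε * (‖cx z‖ ^ 2 + δ * yMass (‖cy z‖ ^ 2)) ≤ 1 / 40 * (4 + 3 / 10) :=
    mul_le_mul hε' (by linarith) (add_nonneg (sq_nonneg _) (mul_nonneg hδ hm0)) (by norm_num)
  nlinarith

/-! ### §3 Flat linear algebra of the Levi gradient -/

section Flat

variable {A : EuclideanSpace ℝ (Fin 4) →L[ℝ] EuclideanSpace ℝ (Fin 4) →L[ℝ] ℝ}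
  (hsymm : ∀ u v, A u v = A v u)

include hsymm in
/-- `h(G, J₀G) = 0` for the Levi form `h(u,v) = A(u,v) + A(J₀u, J₀v)` of a symmetric `A`.
[folklore] -/
theorem levi_self_J_eq_zero (G : EuclideanSpace ℝ (Fin 4)) :
    A G (stdComplexStructure G) +
      A (stdComplexStructure G) (stdComplexStructure (stdComplexStructure G)) = 0 := by
  rw [stdComplexStructure_sq, map_neg, hsymm (stdComplexStructure G) G]
  ring

include hsymm in
/-- `dd^ℂ`-type combination: `A(J₀G, J₀v) - A(v, J₀J₀G) = h(G, v)`. [folklore] -/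
theorem levi_ddc_combination (G v : EuclideanSpace ℝ (Fin 4)) :
    A (stdComplexStructure G) (stdComplexStructure v) -
        A v (stdComplexStructure (stdComplexStructure G)) =
      A G v + A (stdComplexStructure G) (stdComplexStructure v) := by
  rw [stdComplexStructure_sq, map_neg, hsymm v G]
  ring

end Flat

/-- **Decomposition of `ker Dw` at a point where `Dw(G) = 0`**: `v ∈ ker Dw` is
`Re λ · G + Im λ · J₀G`, `λ = x(v)/x(G)`. [folklore] -/
theorem exists_eq_combination_of_ker (g : ℕ) {z G v : EuclideanSpace ℝ (Fin 4)} (hy : cy z ≠ 0)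
    (hG : G ≠ 0) (hWG : wD g z G = 0) (hWv : wD g z v = 0) :
    ∃ a b : ℝ, v = a • G + b • stdComplexStructure G := by
  have hA : cx G ≠ 0 := by
    intro hA
    apply hG
    have hB : cy G = 0 := by
      rw [wD_apply] at hWG
      rw [hA, mul_zero, sub_zero] at hWG
      simpa [hy] using hWG
    exact eq_zero_of_cx_cy hA hB
  set lam : ℂ := cx v / cx G with hlam
  have hxv : cx v = lam * cx G := by rw [hlam, div_mul_cancel₀ _ hA]
  have hyv : cy v = lam * cy G := by
    rw [wD_apply] at hWG hWv
    have h2 : (2 : ℂ) * cy z ≠ 0 := mul_ne_zero two_ne_zero hy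
    have eG : cy G = ((2 * g + 1 : ℕ) : ℂ) * cx z ^ (2 * g) * cx G / (2 * cy z) := by
      field_simp; linear_combination hWG
    have ev : cy v = ((2 * g + 1 : ℕ) : ℂ) * cx z ^ (2 * g) * cx v / (2 * cy z) := by
      field_simp; linear_combination hWv
    rw [ev, eG, hxv]; ring
  refine ⟨lam.re, lam.im, ?_⟩
  have h0 : v - (lam.re • G + lam.im • stdComplexStructure G) = 0 := by
    apply eq_zero_of_cx_cy
    · rw [show cx (v - (lam.re • G + lam.im • stdComplexStructure G)) =
          cx v - (cx (lam.re • G) + cx (lam.im • stdComplexStructure G)) by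
        rw [cx_eq, map_sub, map_add], cx_smul, cx_smul, cx_stdComplexStructure, hxv]
      linear_combination (cx G) * (Complex.re_add_im lam).symm
    · rw [show cy (v - (lam.re • G + lam.im • stdComplexStructure G)) =
          cy v - (cy (lam.re • G) + cy (lam.im • stdComplexStructure G)) by
        rw [cy_eq, map_sub, map_add], cy_smul, cy_smul, cy_stdComplexStructure, hyv]
      linear_combination (cy G) * (Complex.re_add_im lam).symm
  exact sub_eq_zero.1 h0

/-- **`ker Dw ∩ ker ℓ = ℝ · J₀G` at a binding point**: if moreover `ℓ(v) = 0`, `ℓ(J₀ G) = 0`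
and `ℓ(G) ≠ 0` for a real linear `ℓ`, then `v = t · J₀ G`. [folklore] -/
theorem eq_smul_of_ker (g : ℕ) {z G v : EuclideanSpace ℝ (Fin 4)} (hy : cy z ≠ 0) (hG : G ≠ 0)
    (hWG : wD g z G = 0) (hWv : wD g z v = 0) (ℓ : EuclideanSpace ℝ (Fin 4) →L[ℝ] ℝ)
    (hℓv : ℓ v = 0) (hℓJ : ℓ (stdComplexStructure G) = 0) (hℓG : ℓ G ≠ 0) :
    ∃ t : ℝ, v = t • stdComplexStructure G := by
  obtain ⟨a, b, hab⟩ := exists_eq_combination_of_ker g hy hG hWG hWv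
  have ha : a = 0 := by
    have := congrArg ℓ hab
    rw [map_add, map_smul, map_smul, hℓv, hℓJ, smul_zero, add_zero, smul_eq_mul] at this
    rcases mul_eq_zero.1 this.symm with h | h
    · exact h
    · exact absurd h hℓG
  refine ⟨b, ?_⟩
  rw [hab, ha, zero_smul, zero_add]

section Bilinear

variable {B : EuclideanSpace ℝ (Fin 4) →L[ℝ] EuclideanSpace ℝ (Fin 4) →L[ℝ] ℝ}
  (hBs : ∀ u v, B u v = B v u)
  (hBJ : ∀ u v, B (stdComplexStructure u) (stdComplexStructure v) = B u v)

include hBs hBJ in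
/-- `B(J₀u, u) = 0` for a symmetric `J₀`-invariant form. [folklore] -/
theorem bil_J_self (u : EuclideanSpace ℝ (Fin 4)) : B (stdComplexStructure u) u = 0 := by
  have h1 := hBJ (stdComplexStructure u) u
  rw [stdComplexStructure_sq, map_neg, neg_apply, hBs u] at h1
  linarith

include hBJ in
/-- `B(J₀u, v) = -B(u, J₀v)` for a `J₀`-invariant form. [folklore] -/
theorem bil_J_left (u v : EuclideanSpace ℝ (Fin 4)) :
    B (stdComplexStructure u) v = -B u (stdComplexStructure v) := by
  have h1 := hBJ u (stdComplexStructure v)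
  rw [stdComplexStructure_sq, map_neg] at h1
  linarith

include hBs hBJ in
/-- **Meridional positivity for a symmetric, `J₀`-invariant, positive form.**  At a point where
`Dw(G) = 0`, `G ≠ 0`, `y ≠ 0`: if `B(G, ·) = ℓ`, then for `e₁, e₂ ∈ ker ℓ` with
`Im(conj(Dw e₁) Dw e₂) > 0` one has `B(J₀e₁, e₂) > 0` — the `B`-complement of `ℂ G` in `ker ℓ`
is a complex line on which `Dw` is a `ℂ`-isomorphism. [cite: Etnyre2006, Lemma 3.3] -/
theorem bil_J_pos_of_meridional (g : ℕ) {z G : EuclideanSpace ℝ (Fin 4)}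
    (hpos : ∀ u, u ≠ 0 → 0 < B u u) (hy : cy z ≠ 0) (hG : G ≠ 0) (hWG : wD g z G = 0)
    {ℓ : EuclideanSpace ℝ (Fin 4) →L[ℝ] ℝ} (hGℓ : ∀ v, B G v = ℓ v)
    {e₁ e₂ : EuclideanSpace ℝ (Fin 4)} (he₁ : ℓ e₁ = 0) (he₂ : ℓ e₂ = 0)
    (him : 0 < (conj (wD g z e₁) * wD g z e₂).im) :
    0 < B (stdComplexStructure e₁) e₂ := by
  have hGG : 0 < B G G := hpos G hG
  have hGGne : B G G ≠ 0 := hGG.ne'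
  -- the basic relations
  have kJGG : B (stdComplexStructure G) G = 0 := bil_J_self hBs hBJ G
  have kGJG : B G (stdComplexStructure G) = 0 := by rw [hBs]; exact kJGG
  have kJGJG : B (stdComplexStructure G) (stdComplexStructure G) = B G G := hBJ G G
  have ke₁G : B e₁ G = 0 := by rw [hBs, hGℓ, he₁]
  have ke₂G : B e₂ G = 0 := by rw [hBs, hGℓ, he₂]
  -- `h`-orthogonal projections off `J₀ G`
  set b₁ : ℝ := B e₁ (stdComplexStructure G) / B G G with hb₁
  set b₂ : ℝ := B e₂ (stdComplexStructure G) / B G G with hb₂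
  set f₁ := e₁ - b₁ • stdComplexStructure G with hf₁
  set f₂ := e₂ - b₂ • stdComplexStructure G with hf₂
  have hb₁' : b₁ * B G G = B e₁ (stdComplexStructure G) := by rw [hb₁, div_mul_cancel₀ _ hGGne]
  have hb₂' : b₂ * B G G = B e₂ (stdComplexStructure G) := by rw [hb₂, div_mul_cancel₀ _ hGGne]
  have hf₁G : B f₁ G = 0 := by
    rw [hf₁, map_sub, map_smul, sub_apply, FunLike.coe_smul, Pi.smul_apply, smul_eq_mul, ke₁G,
      kJGG, mul_zero, sub_zero]
  have hf₂G : B f₂ G = 0 := by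
    rw [hf₂, map_sub, map_smul, sub_apply, FunLike.coe_smul, Pi.smul_apply, smul_eq_mul, ke₂G,
      kJGG, mul_zero, sub_zero]
  have hf₁JG : B f₁ (stdComplexStructure G) = 0 := by
    rw [hf₁, map_sub, map_smul, sub_apply, FunLike.coe_smul, Pi.smul_apply, smul_eq_mul, kJGJG,
      hb₁', sub_self]
  have hf₂JG : B f₂ (stdComplexStructure G) = 0 := by
    rw [hf₂, map_sub, map_smul, sub_apply, FunLike.coe_smul, Pi.smul_apply, smul_eq_mul, kJGJG,
      hb₂', sub_self]
  -- `Dw fᵢ = Dw eᵢ`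
  have hWJG : wD g z (stdComplexStructure G) = 0 := by
    rw [← fderiv_w, fderiv_w_stdComplexStructure, fderiv_w, hWG, mul_zero]
  have hWf₁ : wD g z f₁ = wD g z e₁ := by rw [hf₁, map_sub, map_smul, hWJG, smul_zero, sub_zero]
  have hWf₂ : wD g z f₂ = wD g z e₂ := by rw [hf₂, map_sub, map_smul, hWJG, smul_zero, sub_zero]
  -- `B(J e₁, e₂) = B(J f₁, f₂)`
  have hred : B (stdComplexStructure e₁) e₂ = B (stdComplexStructure f₁) f₂ := by
    have e1 : e₁ = f₁ + b₁ • stdComplexStructure G := by rw [hf₁, sub_add_cancel]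
    have e2 : e₂ = f₂ + b₂ • stdComplexStructure G := by rw [hf₂, sub_add_cancel]
    have k1 : B (stdComplexStructure f₁) (stdComplexStructure G) = 0 := by rw [hBJ]; exact hf₁G
    have k2 : B G f₂ = 0 := by rw [hBs]; exact hf₂G
    conv_lhs => rw [e1, e2]
    simp only [map_add, map_smul, stdComplexStructure_sq, map_neg, add_apply, neg_apply,
      FunLike.coe_smul, Pi.smul_apply, smul_eq_mul]
    linear_combination b₂ * k1 - b₁ * k2 - b₁ * b₂ * kGJG
  rw [hred]
  -- `f₂ = Re λ f₁ + Im λ J f₁`, `λ = Dw f₂ / Dw f₁`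
  have hW₁ : wD g z f₁ ≠ 0 := by
    intro h0
    rw [← hWf₁, h0, map_zero, zero_mul, Complex.zero_im] at him
    exact lt_irrefl _ him
  have hf₁ne : f₁ ≠ 0 := by
    intro h0; apply hW₁; rw [h0, map_zero]
  set lam : ℂ := wD g z f₂ / wD g z f₁ with hlam
  have hlamW : wD g z f₂ = lam * wD g z f₁ := by rw [hlam, div_mul_cancel₀ _ hW₁]
  set d := f₂ - (lam.re • f₁ + lam.im • stdComplexStructure f₁) with hd
  have hWd : wD g z d = 0 := by
    rw [hd, map_sub, map_add, map_smul, map_smul, ← fderiv_w, fderiv_w_stdComplexStructure,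
      fderiv_w, hlamW, Complex.real_smul, Complex.real_smul]
    linear_combination (wD g z f₁) * (Complex.re_add_im lam).symm
  obtain ⟨a, b, hab⟩ := exists_eq_combination_of_ker g hy hG hWG hWd
  -- `d` is `B`-orthogonal to `G`, `J G`; `B(d, d) = 0`; `d = 0`
  have kJf₁G : B (stdComplexStructure f₁) G = 0 := by
    rw [bil_J_left hBJ, hf₁JG, neg_zero]
  have kJf₁JG : B (stdComplexStructure f₁) (stdComplexStructure G) = 0 := by rw [hBJ]; exact hf₁G
  have hdG : B d G = 0 := by
    rw [hd, map_sub, map_add, map_smul, map_smul]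
    simp only [sub_apply, add_apply, FunLike.coe_smul, Pi.smul_apply, smul_eq_mul]
    rw [hf₂G, hf₁G, kJf₁G]; ring
  have hdJG : B d (stdComplexStructure G) = 0 := by
    rw [hd, map_sub, map_add, map_smul, map_smul]
    simp only [sub_apply, add_apply, FunLike.coe_smul, Pi.smul_apply, smul_eq_mul]
    rw [hf₂JG, hf₁JG, kJf₁JG]; ring
  have hdd : B d d = 0 := by
    have : B d d = B d (a • G + b • stdComplexStructure G) := by rw [← hab]
    rw [this, map_add, map_smul, map_smul, hdG, hdJG, smul_zero, smul_zero, add_zero]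
  have hd0 : d = 0 := by
    by_contra hne
    have := hpos d hne
    rw [hdd] at this
    exact lt_irrefl _ this
  have hf₂eq : f₂ = lam.re • f₁ + lam.im • stdComplexStructure f₁ := sub_eq_zero.1 hd0
  -- evaluate
  have hval : B (stdComplexStructure f₁) f₂ = lam.im * B f₁ f₁ := by
    rw [hf₂eq, map_add, map_smul, map_smul, bil_J_self hBs hBJ f₁, hBJ f₁ f₁, smul_zero, zero_add,
      smul_eq_mul]
  have hIm : 0 < lam.im := by
    rw [← hWf₁, ← hWf₂, hlamW] at him
    have : conj (wD g z f₁) * (lam * wD g z f₁) = lam * ((‖wD g z f₁‖ ^ 2 : ℝ) : ℂ) := by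
      rw [Complex.ofReal_pow, ← Complex.conj_mul']; ring
    rw [this, Complex.mul_im, Complex.ofReal_re, Complex.ofReal_im, mul_zero] at him
    have him' : 0 < lam.im * ‖wD g z f₁‖ ^ 2 := by linarith
    exact pos_of_mul_pos_left him' (sq_nonneg _)
  rw [hval]
  exact mul_pos hIm (hpos f₁ hf₁ne)

end Bilinear

/-- **The flat Levi form as a bilinear map**:
`(A + ((A ∘ J₀)ᵗ ∘ J₀)ᵗ)(u, v) = A(u, v) + A(J₀u, J₀v)`. [folklore] -/
theorem leviCLM_apply (A : EuclideanSpace ℝ (Fin 4) →L[ℝ] EuclideanSpace ℝ (Fin 4) →L[ℝ] ℝ)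
    (u v : EuclideanSpace ℝ (Fin 4)) :
    (A + ((A.comp stdComplexStructure).flip.comp stdComplexStructure).flip) u v =
      A u v + A (stdComplexStructure u) (stdComplexStructure v) := by
  simp [ContinuousLinearMap.flip_apply, ContinuousLinearMap.comp_apply]

/-- **`-dd^ℂΨ(e₁, e₂) = h(J₀e₁, e₂)`** for symmetric `A = D²Ψ`, in Mathlib's normalisation
`dd^ℂΨ(a, b) = A(a, J₀b) - A(b, J₀a)`. [folklore] -/
theorem neg_ddc_eq_levi {A : EuclideanSpace ℝ (Fin 4) →L[ℝ] EuclideanSpace ℝ (Fin 4) →L[ℝ] ℝ}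
    (hsymm : ∀ u v, A u v = A v u) (e₁ e₂ : EuclideanSpace ℝ (Fin 4)) :
    -(A e₁ (stdComplexStructure e₂) - A e₂ (stdComplexStructure e₁)) =
      A (stdComplexStructure e₁) e₂ +
        A (stdComplexStructure (stdComplexStructure e₁)) (stdComplexStructure e₂) := by
  rw [stdComplexStructure_sq, map_neg, neg_apply, hsymm e₂ (stdComplexStructure e₁)]
  ring


/-! ### §4 The handle-free case of the named fact -/

/-- **PALF ⇒ Stein with supported Kas open book, handle-free case.**  For an empty family of
vanishing cycles the conclusion of `palf_stein_supportedByBoundaryOpenBook` holds: every compact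
multi-attachment `(X, D)` of `h : ι → …`, `IsEmpty ι`, with a Kas open book `ob` on a boundary
datum `bX`, carries a Stein structure whose complex tangencies admit a Giroux form of `ob`,
positive for the complex boundary orientation.  (Torisu's theorem for `D² × F`, `F` the planar
page of the Lefschetz base, in the tree's formulation.)
[cite: AkbulutOzbagci2001, Thm. 5 (proof, first step)] [cite: Etnyre2006, Thm. 5.6] -/
theorem palf_stein_supportedByBoundaryOpenBook_handleFree (g : ℕ) {ι : Type} [Finite ι]
    [IsEmpty ι] (h : ι → HandleAttachingMap 3 2 (Base g))
    {X : Type} [TopologicalSpace X] [T2Space X] [ChartedSpace (EuclideanHalfSpace 4) X]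
    [IsManifold (𝓡∂ 4) ∞ X] [CompactSpace X]
    (D : MultiAttachmentData h (𝓡∂ 4) X) (bX : BoundaryData (𝓡∂ 4) X (𝓡 3))
    (ob : OpenBook bX.carrier) (hK : IsKasOpenBookOf g h D bX.incl ob) :
    ∃ (S' : SteinStructure X) (α : MForm (𝓡 3) bX.carrier ℝ 1),
      ob.IsGirouxForm (boundaryPlaneField S'.J bX) α ∧
      ∀ (y : bX.carrier) (a : ↥(coresComplement h)) (u : Fin 3 → EuclideanSpace ℝ (Fin 3))
        (v : Fin 3 → EuclideanSpace ℝ (Fin 4)),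
        bX.incl y = D.jA a →
        (∀ k, mfderiv (𝓡 3) (𝓡∂ 4) bX.incl y (u k) = mfderiv (𝓡∂ 4) (𝓡∂ 4) D.jA a (v k)) →
        IsPosBdryFrame h a v →
        0 < wedge₁₂ (α y) (mextDeriv α y) (u 0) (u 1) (u 2) := by
  -- thresholds of the transversality estimate, then the model below them
  obtain ⟨δ₁, hδ₁, ε₁, hε₁, Hpos⟩ := exists_re_conj_w_mul_wD_pos g
  obtain ⟨δ, hδ, hδle, ε, hε, hεle, hΨ, _, Φ, e, S, he, hle, heq, hw, hdet, hpsh, hSφ, hSJ⟩ :=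
    exists_steinStructure_model_orient_le g (lt_min hδ₁ one_pos)
      (lt_min hε₁ (by norm_num : (0 : ℝ) < 1 / 40))
  have hδ1 : δ ≤ δ₁ := hδle.trans (min_le_left _ _)
  have hδ1' : δ ≤ 1 := hδle.trans (min_le_right _ _)
  have hε1 : ε ≤ ε₁ := hεle.trans (min_le_left _ _)
  have hε40 : ε ≤ 1 / 40 := hεle.trans (min_le_right _ _)
  set Ψ := modelFun g ε (qPert δ) with hΨdef
  have hΨs : ContDiff ℝ ∞ Ψ := contDiff_modelFun g ε (contDiff_qPert δ)
  have hsymm : ∀ z u u', fderiv ℝ (fderiv ℝ Ψ) z u u' = fderiv ℝ (fderiv ℝ Ψ) z u' u :=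
    fun z u u' => ((hΨs.of_le (by norm_cast)).contDiffAt (x := z)).isSymmSndFDerivAt
      (n := 2) (by simp) u u'
  -- Levi positivity on the level
  have hposL : ∀ z, Ψ z = 1 / 4 → ∀ u : EuclideanSpace ℝ (Fin 4), u ≠ 0 →
      0 < fderiv ℝ (fderiv ℝ Ψ) z u u +
        fderiv ℝ (fderiv ℝ Ψ) z (stdComplexStructure u) (stdComplexStructure u) :=
    fun z hz u hu => hpsh z ((rho_le_modelFun g hε.le (qPert_nonneg hδ.le) z).trans hz.le) u hu
  -- the Levi gradient `G` on the level (junk elsewhere)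
  have hGex : ∀ z, ∃ G : EuclideanSpace ℝ (Fin 4), Ψ z = 1 / 4 →
      ∀ v, fderiv ℝ (fderiv ℝ Ψ) z G v +
        fderiv ℝ (fderiv ℝ Ψ) z (stdComplexStructure G) (stdComplexStructure v) =
          fderiv ℝ Ψ z v := by
    intro z
    by_cases hz : Ψ z = 1 / 4
    · obtain ⟨G, hG⟩ := exists_leviGradient stdComplexStructure (fderiv ℝ (fderiv ℝ Ψ) z)
        (hposL z hz) (fderiv ℝ Ψ z)
      exact ⟨G, fun _ => hG⟩
    · exact ⟨0, fun h' => absurd h' hz⟩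
  choose G hG using hGex
  have hG0 : ∀ z, Ψ z = 1 / 4 → G z ≠ 0 := by
    intro z hz h0
    apply fderiv_ne_zero_of_eq_level hΨ hz
    ext v
    have := hG z hz v
    rw [h0, map_zero, map_zero, zero_apply, map_zero,
      zero_apply, add_zero] at this
    exact this.symm
  -- `dΨ(G) > 0`, `dΨ(J₀ G) = 0`
  have hdG : ∀ z, Ψ z = 1 / 4 → 0 < fderiv ℝ Ψ z (G z) := by
    intro z hz
    rw [← hG z hz (G z)]
    exact hposL z hz (G z) (hG0 z hz)
  have hdJG : ∀ z, Ψ z = 1 / 4 → fderiv ℝ Ψ z (stdComplexStructure (G z)) = 0 := by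
    intro z hz
    rw [← hG z hz]
    exact levi_self_J_eq_zero (hsymm z) (G z)
  -- the field `R = J₀ G` and the flat Reeb conditions
  set R : EuclideanSpace ℝ (Fin 4) → EuclideanSpace ℝ (Fin 4) :=
    fun z => stdComplexStructure (G z) with hR
  have hF0 : ∀ z, Ψ z = 1 / 4 → fderiv ℝ Ψ z (R z) = 0 := fun z hz => hdJG z hz
  have hF1 : ∀ z, Ψ z = 1 / 4 → 0 < -(fderiv ℝ Ψ z (stdComplexStructure (R z))) := by
    intro z hz
    simp only [hR, stdComplexStructure_sq, map_neg, neg_neg]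
    exact hdG z hz
  have hF2 : ∀ z, Ψ z = 1 / 4 → ∀ v, fderiv ℝ Ψ z v = 0 →
      extDeriv (dComplexFlat stdComplexStructure Ψ) z ![R z, v] = 0 := by
    intro z hz v hv
    rw [extDeriv_dComplexFlat_apply stdComplexStructure hΨs, hR]
    rw [levi_ddc_combination (hsymm z), hG z hz v, hv]
  have hF3 : ∀ z, Ψ z = 1 / 4 → w g z ≠ 0 →
      0 < (conj (w g z) * fderiv ℝ (w g) z (R z)).im := by
    intro z hz hwz
    have hpos := Hpos δ hδ hδ1 ε hε hε1 z (G z) hz hwz (hG z hz)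
    rw [hR]
    show 0 < (conj (w g z) * fderiv ℝ (w g) z (stdComplexStructure (G z))).im
    rw [fderiv_w_stdComplexStructure, fderiv_w]
    have : conj (w g z) * (I * wD g z (G z)) = I * (conj (w g z) * wD g z (G z)) := by ring
    rw [this, Complex.I_mul_im]
    exact hpos
  have hF4 : ∀ z, Ψ z = 1 / 4 → w g z = 0 → ∀ v, fderiv ℝ Ψ z v = 0 → fderiv ℝ (w g) z v = 0 →
      ∃ t : ℝ, v = t • R z := by
    intro z hz hwz v hv hwv
    have ht : 3 / 10 < ‖cy z‖ ^ 2 := norm_sq_cy_gt_of_binding_level hε40 hδ.le hδ1' hz hwz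
    have hκ : 0 < deriv convexProfile (‖cx z‖ ^ 2) +
        ‖cx z‖ ^ 2 * deriv (deriv convexProfile) (‖cx z‖ ^ 2) + ε := by
      have := levi_coeff_convexProfile_nonneg (sq_nonneg ‖cx z‖)
      linarith
    have hWG : wD g z (G z) = 0 := by
      rw [wD_leviGradient_of_gt g z (G z) (hG z hz) ht hκ, hwz, zero_div]
    have hy : cy z ≠ 0 := by
      intro h0; rw [h0, norm_zero] at ht; norm_num at ht
    rw [fderiv_w] at hwv
    exact eq_smul_of_ker g hy (hG0 z hz) hWG hwv (fderiv ℝ Ψ z) hv (hdJG z hz) (hdG z hz).ne'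
  have hF5 : ∀ z, Ψ z = 1 / 4 → w g z = 0 → ∀ e₁ e₂ : EuclideanSpace ℝ (Fin 4),
      fderiv ℝ Ψ z e₁ = 0 → fderiv ℝ Ψ z e₂ = 0 →
      0 < (conj (fderiv ℝ (w g) z e₁) * fderiv ℝ (w g) z e₂).im →
      0 < -(extDeriv (dComplexFlat stdComplexStructure Ψ) z ![e₁, e₂]) := by
    intro z hz hwz e₁ e₂ h₁ h₂ him
    have ht : 3 / 10 < ‖cy z‖ ^ 2 := norm_sq_cy_gt_of_binding_level hε40 hδ.le hδ1' hz hwz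
    have hκ : 0 < deriv convexProfile (‖cx z‖ ^ 2) +
        ‖cx z‖ ^ 2 * deriv (deriv convexProfile) (‖cx z‖ ^ 2) + ε := by
      have := levi_coeff_convexProfile_nonneg (sq_nonneg ‖cx z‖)
      linarith
    have hWG : wD g z (G z) = 0 := by
      rw [wD_leviGradient_of_gt g z (G z) (hG z hz) ht hκ, hwz, zero_div]
    have hy : cy z ≠ 0 := by
      intro h0; rw [h0, norm_zero] at ht; norm_num at ht
    rw [fderiv_w] at him
    rw [extDeriv_dComplexFlat_apply stdComplexStructure hΨs, neg_ddc_eq_levi (hsymm z),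
      ← leviCLM_apply (fderiv ℝ (fderiv ℝ Ψ) z) (stdComplexStructure e₁) e₂]
    refine bil_J_pos_of_meridional (B := fderiv ℝ (fderiv ℝ Ψ) z +
      (((fderiv ℝ (fderiv ℝ Ψ) z).comp stdComplexStructure).flip.comp stdComplexStructure).flip)
      (fun u v => ?_) (fun u v => ?_) g (fun u hu => ?_) hy (hG0 z hz) hWG (ℓ := fderiv ℝ Ψ z)
      (fun v => ?_) h₁ h₂ him
    · rw [leviCLM_apply, leviCLM_apply, hsymm z u v, hsymm z (stdComplexStructure u)]
    · simp only [leviCLM_apply, stdComplexStructure_sq, map_neg, neg_apply, neg_neg]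
      ring
    · rw [leviCLM_apply]; exact hposL z hz u hu
    · rw [leviCLM_apply]; exact hG z hz v
  exact palf_conclusion_of_flatReebModel g hΨ e Φ he hw R hF0 S hSJ hSφ hle heq hdet hF1 hF2 hF3
    hF4 hF5 h D bX ob hK

/-! ### §5 Torisu's theorem for `F × D²` in the tree's formulation, unconditionally -/

/-- **`Base g` (on paper `F_{g,1} × D²`, `F` the page of the Lefschetz base) carries a Stein
structure whose complex tangencies on `∂ Base g` admit a Giroux form for the trivial boundary
open book `boundaryOpenBook g` (binding `{w = 0}`, fibration `w/‖w‖`), positive for the complex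
boundary orientation** — the statement `palf_stein_supportedByBoundaryOpenBook.base_case` of
`LefschetzSteinOpenBookBaseCase.lean`, now WITHOUT the hypothesis `hfact`.
[cite: AkbulutOzbagci2001, Thm. 5 (proof, first step)] [cite: Etnyre2006, Thm. 5.6] -/
theorem palf_stein_supportedByBoundaryOpenBook_base_holds (g : ℕ)
    (h₀ : Empty → HandleAttachingMap 3 2 (Base g)) :
    ∃ (S : SteinStructure (Base g)) (α : MForm (𝓡 3) (bBase g).carrier ℝ 1),
      (boundaryOpenBook g).IsGirouxForm (boundaryPlaneField S.J (bBase g)) α ∧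
      ∀ (y : (bBase g).carrier) (a : ↥(coresComplement h₀)) (u : Fin 3 → EuclideanSpace ℝ (Fin 3))
        (v : Fin 3 → EuclideanSpace ℝ (Fin 4)),
        (bBase g).incl y = (a : Base g) →
        (∀ k, mfderiv (𝓡 3) (𝓡∂ 4) (bBase g).incl y (u k) =
          mfderiv (𝓡∂ 4) (𝓡∂ 4) (Subtype.val : ↥(coresComplement h₀) → Base g) a (v k)) →
        IsPosBdryFrame h₀ a v →
        0 < wedge₁₂ (α y) (mextDeriv α y) (u 0) (u 1) (u 2) := by
  obtain ⟨D, hjA, hK⟩ := exists_multiAttachmentData_isKasOpenBookOf_base g h₀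
  obtain ⟨S, α, hG, hpos⟩ :=
    palf_stein_supportedByBoundaryOpenBook_handleFree g h₀ D (bBase g) (boundaryOpenBook g) hK
  refine ⟨S, α, hG, fun y a u v hya hd hfr => hpos y a u v ?_ ?_ hfr⟩
  · rw [hjA]; exact hya
  · intro k; rw [hjA]; exact hd k

/-! ### §6 Genus zero: disc pages carry no allowable vanishing cycle -/

/-- For `g = 0` every homology shadow vanishes: `shadow 0 K hK : Fin 0 ⊕ Fin 0 → ℤ` lives in a
one-point type (`H₁(Base 0; ℤ) = 0`, the page `F_{0,1}` being a disc). [folklore] -/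
theorem shadow_genus_zero (K : (Metric.sphere (0 : EuclideanSpace ℝ (Fin 2)) 1) → Base 0)
    (hK : Continuous K) : shadow 0 K hK = 0 :=
  Subsingleton.elim _ _

/-- For `g = 0` an ALLOWABLE family of vanishing cycles (`shadow ≠ 0` for every member) is
empty: a disc has no homologically non-trivial curve (Akbulut–Ozbagci 2001, §2: "allowable iff
all its vanishing cycles are homologically non-trivial in the fiber"). [folklore] -/
theorem isEmpty_of_shadow_ne_zero_genus_zero {ι : Type*} (h : ι → HandleAttachingMap 3 2 (Base 0))
    (hsh : ∀ i, shadow 0 (h i).attachingCircle (h i).continuous_attachingCircle ≠ 0) :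
    IsEmpty ι :=
  ⟨fun i => hsh i (shadow_genus_zero _ _)⟩

/-- **PALF ⇒ Stein with supported Kas open book, genus-zero base.**  Over `Base 0` (disc
pages) the conclusion of `palf_stein_supportedByBoundaryOpenBook` holds for EVERY finite family
of Lefschetz handles satisfying its allowability hypothesis: that hypothesis forces the family to
be empty (`isEmpty_of_shadow_ne_zero_genus_zero`), and the handle-free case
`palf_stein_supportedByBoundaryOpenBook_handleFree` applies (the Stein filling `B⁴ ≅ D² × D²` of
the open book with disc pages).  The page and page-twisting hypotheses of the fact are not
needed. [cite: AkbulutOzbagci2001, Thm. 5 (proof, first step)] [cite: Etnyre2006, Thm. 5.6] -/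
theorem palf_stein_supportedByBoundaryOpenBook_genus_zero {ι : Type} [Finite ι]
    (h : ι → HandleAttachingMap 3 2 (Base 0))
    {X : Type} [TopologicalSpace X] [T2Space X] [ChartedSpace (EuclideanHalfSpace 4) X]
    [IsManifold (𝓡∂ 4) ∞ X] [CompactSpace X]
    (D : MultiAttachmentData h (𝓡∂ 4) X) (bX : BoundaryData (𝓡∂ 4) X (𝓡 3))
    (ob : OpenBook bX.carrier)
    (hsh : ∀ i, shadow 0 (h i).attachingCircle (h i).continuous_attachingCircle ≠ 0)
    (hK : IsKasOpenBookOf 0 h D bX.incl ob) :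
    ∃ (S' : SteinStructure X) (α : MForm (𝓡 3) bX.carrier ℝ 1),
      ob.IsGirouxForm (boundaryPlaneField S'.J bX) α ∧
      ∀ (y : bX.carrier) (a : ↥(coresComplement h)) (u : Fin 3 → EuclideanSpace ℝ (Fin 3))
        (v : Fin 3 → EuclideanSpace ℝ (Fin 4)),
        bX.incl y = D.jA a →
        (∀ k, mfderiv (𝓡 3) (𝓡∂ 4) bX.incl y (u k) = mfderiv (𝓡∂ 4) (𝓡∂ 4) D.jA a (v k)) →
        IsPosBdryFrame h a v →
        0 < wedge₁₂ (α y) (mextDeriv α y) (u 0) (u 1) (u 2) := by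
  haveI : IsEmpty ι := isEmpty_of_shadow_ne_zero_genus_zero h hsh
  exact palf_stein_supportedByBoundaryOpenBook_handleFree 0 h D bX ob hK

/-- **The named fact at genus `0`, in its own shape.**  `palf_stein_supportedByBoundaryOpenBook`
specialised to `g = 0` holds outright (all four hypotheses kept as printed; only allowability and
the Kas clause are used). [cite: AkbulutOzbagci2001, Thm. 5] [cite: Etnyre2006, Thm. 5.6] -/
theorem palf_stein_supportedByBoundaryOpenBook_zero :
    ∀ (ι : Type) [Finite ι] (X : Type) [TopologicalSpace X] [T2Space X]
      [SecondCountableTopology X] [CompactSpace X] [ChartedSpace (EuclideanHalfSpace 4) X]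
      [IsManifold (𝓡∂ 4) ∞ X]
      (h : ι → HandleAttachingMap 3 2 (Base 0)) (D : MultiAttachmentData h (𝓡∂ 4) X)
      (bX : BoundaryData (𝓡∂ 4) X (𝓡 3)) (ob : OpenBook bX.carrier),
      (∀ i, ∃ c : ℂ, ‖c‖ = 1 ∧ ∀ θ, (h i).attachingCircle θ ∈ page 0 c) →
      (∀ i, shadow 0 (h i).attachingCircle (h i).continuous_attachingCircle ≠ 0) →
      (∀ i, pageTwisting 0 (h i).attachingCircle (h i).attachingFraming = -1) →
      IsKasOpenBookOf 0 h D bX.incl ob →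
      ∃ (S : SteinStructure X) (α : MForm (𝓡 3) bX.carrier ℝ 1),
        ob.IsGirouxForm (boundaryPlaneField S.J bX) α ∧
        ∀ (y : bX.carrier) (a : ↥(coresComplement h)) (u : Fin 3 → EuclideanSpace ℝ (Fin 3))
          (v : Fin 3 → EuclideanSpace ℝ (Fin 4)),
          bX.incl y = D.jA a →
          (∀ k, mfderiv (𝓡 3) (𝓡∂ 4) bX.incl y (u k) = mfderiv (𝓡∂ 4) (𝓡∂ 4) D.jA a (v k)) →
          IsPosBdryFrame h a v →
          0 < wedge₁₂ (α y) (mextDeriv α y) (u 0) (u 1) (u 2) := by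
  intro ι _ X _ _ _ _ _ _ h D bX ob _ hsh _ hK
  exact palf_stein_supportedByBoundaryOpenBook_genus_zero h D bX ob hsh hK

end Literature.Geometry.Symplectic

end
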